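import Literature.AlgebraicGeometry.Motives.AbelianVarietyWeilDivisorClassPullbackHom
import Literature.AlgebraicGeometry.Motives.AbelianVarietyPrincipalPolarization
import HarnessLib

/-!
# `K(Θ) = 0` from the injectivity of `x ↦ aj(f^♮(t_x^*Θ − Θ))` — the «`φ_Θ` is injective» half of the principality of
# Riemann's theta divisor from Lange's Cor. 4.4.5 «`(α_c^*)⁻¹ = −φ_Θ`» (Lange 2023 §4.4.2; Milne JV Thm. 6.6; Mumford §6, §8)

Layer `Literature/AlgebraicGeometry/Motives`, namespace `Literature.AlgebraicGeometry.Motives.AbelianVariety`.  KERNEL ONLY: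
theorems; no definition, no named fact, no instance, no `sorry`.  Generic: any field `k`, any abelian variety `A/k`, any
morphism `f : Z → A` from an integral scheme, any class function `aj : CartierDivisor Z → A(k)` constant on linear equivalence
classes.

* `KTheta_eq_bot_of_injective_aj_classPullback_weilDiv` — if `x ↦ aj(f^♮ D_x^Θ)` is injective on `A(k)` then
  `K(Θ)(k) = {x | D_x^Θ ∼ 0} = ⊥` (`D_x ∼ 0 = D_1` forces `aj(f^♮ D_x) = aj(f^♮ D_1)`).
* `KTheta_eq_bot_of_aj_classPullback_weilDiv_eq_inv` / `_eq_mul_inv` — in particular when `aj(f^♮ D_x^Θ) = x⁻¹` (Lange's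
  Cor. 4.4.5 «`(α_c^*)⁻¹ = −φ_Θ`» in points currency, the shape produced by the cell `hodgecm-mathlib` road G4: ★
  `AbelianVariety.aj_classPullback_weilDiv_eq_inv_of_translate`) or `= κ · x⁻¹`.
* `isPrincipalPolarizationDivisor_of_isAmple_of_aj_classPullback_weilDiv_eq_inv` — hence an AMPLE such `Θ` is a principal
  polarisation divisor (★ `IsPrincipalPolarizationDivisor` = ample ∧ `K(Θ)(k) = ⊥`).

Consumer (cell `hodgecm-mathlib`, D-0151): the named fact VI-7 ★ `Jacobian.riemann_brillNoetherLocus_isPrincipalPolarizationDivisor`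
(«`W̃_{g−1}` defines a PRINCIPAL polarisation», [Milne1986JacobianVarieties] Thm. 6.6 «`φ_{L(Θ)}` is an isomorphism») splits as
AMPLENESS of the prime divisor `[W̃_{g−1}]` + `K = ⊥`; this file turns the G4 road's Cor. 4.4.5 for `[W̃_{g−1}]` into the second
half.  COUNT-NEUTRAL: nothing here proves Cor. 4.4.5 or ampleness.  HC_CM is proved only modulo the 7 printed citations until
rung 0 closes.

## References
* [Lange2023AbelianVarietiesComplex] H. Lange, *Abelian Varieties over the Complex Numbers* (2023), §4.4.2 Cor. 4.4.5, §2.1.1.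
* [Milne1986JacobianVarieties] J. S. Milne, *Jacobian Varieties*, in Cornell–Silverman (1986), §6 Thm. 6.6 and Lemma 6.9.
* [MumfordAV1970] D. Mumford, *Abelian Varieties* (1970), §6 Definition (p. 60), §8 (`K(L)`, `φ_L`, pp. 74–75).
-/

set_option autoImplicit false

noncomputable section

universe u

open CategoryTheory AlgebraicGeometry

namespace Literature.AlgebraicGeometry.Motives

namespace AbelianVariety

variable {k : Type u} [Field k] {A : AbelianVariety k} {Z : Scheme.{u}} [IsIntegral Z]
  (f : Z ⟶ A.X.left) (aj : CartierDivisor Z → A.Points k)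
  (haj_lin : ∀ D E : CartierDivisor Z, D.LinEquiv E → aj D = aj E) (Θ : CartierDivisor A.X.left)
include haj_lin

/-- **`K(Θ)(k) = ⊥` when `x ↦ aj(f^♮ D_x^Θ)` is injective** (`D_x := t_x^*Θ − Θ`, `f^♮` the class pull-back): for
`x ∈ K(Θ)` the divisor `D_x` is principal, `D_x ∼ 0 ∼ D_1` (★ `weilDiv_one_linEquiv_zero`), so the class function takes the
same value at `x` and at `1` (★ `LinEquiv.classPullback`). [cite: MumfordAV1970, §6 Definition (p. 60) and §8 (pp. 74–75)]
[cite: Lange2023AbelianVarietiesComplex, §4.4.2 Cor. 4.4.5] -/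
theorem KTheta_eq_bot_of_injective_aj_classPullback_weilDiv
    (hinj : Function.Injective fun x : A.Points k => aj ((A.weilDiv Θ x).classPullback f)) : A.KTheta Θ = ⊥ := by
  refine (Subgroup.eq_bot_iff_forall _).mpr fun x hx => hinj ?_
  have h : (A.weilDiv Θ x).LinEquiv (A.weilDiv Θ 1) :=
    ((A.mem_KTheta_iff Θ x).mp hx).trans (A.weilDiv_one_linEquiv_zero Θ).symm
  exact haj_lin _ _ (h.classPullback f)

/-- **Lange's Cor. 4.4.5 shape ⇒ `K(Θ)(k) = ⊥`**: if `aj(f^♮ D_x^Θ) = x⁻¹` for all `x ∈ A(k)` («`(α_c^*)⁻¹ = −φ_Θ`» read on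
points), then `K(Θ)(k)` is trivial — the «`φ_Θ` is injective» half of [Milne1986JacobianVarieties] Thm. 6.6.
[cite: Lange2023AbelianVarietiesComplex, §4.4.2 Cor. 4.4.5] [cite: Milne1986JacobianVarieties, §6 Thm. 6.6 and Lemma 6.9] -/
theorem KTheta_eq_bot_of_aj_classPullback_weilDiv_eq_inv
    (h : ∀ x : A.Points k, aj ((A.weilDiv Θ x).classPullback f) = x⁻¹) : A.KTheta Θ = ⊥ :=
  KTheta_eq_bot_of_injective_aj_classPullback_weilDiv f aj haj_lin Θ fun x y hxy => by
    have h' : x⁻¹ = y⁻¹ := by rw [← h x, ← h y]; exact hxy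
    exact inv_injective h'

/-- The same with a constant: `aj(f^♮ D_x^Θ) = κ · x⁻¹` for all `x` (the normalised Step I shape of the G4 road) gives
`K(Θ)(k) = ⊥`. [cite: Lange2023AbelianVarietiesComplex, §4.4.2 Cor. 4.4.5] -/
theorem KTheta_eq_bot_of_aj_classPullback_weilDiv_eq_mul_inv (κ : A.Points k)
    (h : ∀ x : A.Points k, aj ((A.weilDiv Θ x).classPullback f) = κ * x⁻¹) : A.KTheta Θ = ⊥ :=
  KTheta_eq_bot_of_injective_aj_classPullback_weilDiv f aj haj_lin Θ fun x y hxy => by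
    have h' : κ * x⁻¹ = κ * y⁻¹ := by rw [← h x, ← h y]; exact hxy
    exact inv_injective (mul_left_cancel h')

/-- **An AMPLE divisor satisfying Lange's Cor. 4.4.5 shape is a principal polarisation divisor** (ample ∧ `K(Θ)(k) = ⊥`,
★ `IsPrincipalPolarizationDivisor`): the G4-road form of «`φ_{L(Θ)} : J → J^∨` is an isomorphism» for Riemann's theta
divisor, modulo its ampleness. [cite: Milne1986JacobianVarieties, §6 Thm. 6.6 and Lemma 6.9]
[cite: Lange2023AbelianVarietiesComplex, §4.4.2 Cor. 4.4.5] -/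
theorem isPrincipalPolarizationDivisor_of_isAmple_of_aj_classPullback_weilDiv_eq_inv (hamp : Θ.IsAmple)
    (h : ∀ x : A.Points k, aj ((A.weilDiv Θ x).classPullback f) = x⁻¹) : A.IsPrincipalPolarizationDivisor Θ :=
  ⟨hamp, KTheta_eq_bot_of_aj_classPullback_weilDiv_eq_inv f aj haj_lin Θ h⟩

end AbelianVariety

end Literature.AlgebraicGeometry.Motives

end
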